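import Literature.AlgebraicGeometry.Frobenioids.Prop53Sub
import Literature.AlgebraicGeometry.Frobenioids.Prop55iiiRlfModel
import HarnessLib

/-!
# Frobenioids I, Prop. 5.3: the slots `RlfDivisorial` and `RealSpanGroupLike` of the Prop. 5.3 sub-DAG — CLOSED

Mochizuki, *The geometry of Frobenioids I*, Kyushu J. Math. **62** (2008), Prop. 5.3 p. 103 ("the model Frobenioid
[cf. Theorem 5.2, (ii)] associated to the divisor monoid `Φ^rlf` … and the rational function monoid `ℝ · Φ^birat`":
Thm. 5.2's hypotheses "`Φ` divisorial", "`B` group-like" at THE realified data) [cite: MochizukiFrdI2008, Prop. 5.3 p.103].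

PROOF-ONLY closers of two named rows of `Prop53Sub.lean` (seat abc-iut-w5-d137, sub-DAG W3 [FrdI] Prop 5.3 + Cor 5.4,
rows P53/L02b and P53/L02c'), by the landed theorems of `Prop55iiiRlfModel.lean` (seat abc-iut-L1-d2):
`FrdI.Prop53Sub.rlfDivisorial_holds` (`Φ^rlf` is objectwise divisorial — `RealificationData.canonical_rlf_isDivisorial`,
i.e. `IsPerfFactorial.Rlf.isDivisorial`) and `FrdI.Prop53Sub.realSpanGroupLike_holds` (`ℝ · Ψ` is objectwise group-like —
`RealificationData.realSpan_toMonoid_isGroupLike`).  Seat abc-iut-L1-d2 (cell abc-iut).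
-/

noncomputable section

namespace Literature.AlgebraicGeometry.Frobenioids

open CategoryTheory Opposite Literature.AnabelianGeometry.EtaleTheta

universe w v u

namespace FrdI.Prop53Sub

variable {D : Type u} [Category.{v} D] {Φ : Dᵒᵖ ⥤ CommMonCat.{w}}

/-- **Row P53/L02b CLOSED: `Φ^rlf` is (objectwise) divisorial** (Def. 2.4 (i): `M^rlf` is divisorial).
[cite: MochizukiFrdI2008, Prop. 5.3 p.103] -/
theorem rlfDivisorial_holds (hΦ : ∀ X : Dᵒᵖ, IsPerfFactorial (Φ.obj X)) : RlfDivisorial Φ hΦ :=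
  RealificationData.canonical_rlf_isDivisorial hΦ

/-- **Row P53/L02c' CLOSED: `ℝ · Ψ` is (objectwise) group-like** (a subfunctor of GROUPS of `(Φ^rlf)^gp`).
[cite: MochizukiFrdI2008, Prop. 5.3 p.103] -/
theorem realSpanGroupLike_holds (R : RealificationData Φ) (Ψ : GpSubfunctor Φ) : RealSpanGroupLike R Ψ :=
  R.realSpan_toMonoid_isGroupLike Ψ

end FrdI.Prop53Sub

end Literature.AlgebraicGeometry.Frobenioids
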